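import Summits.QuantumFields.YangMills.Theorems.BalabanUVNodesN07DentPairDataSmall
import Summits.QuantumFields.YangMills.Theorems.BalabanUVNodesN07DentBlockDataSmall
import Summits.QuantumFields.YangMills.Theorems.BalabanUVNodesN07ChartTopBoxPlaquetteValuesB
import HarnessLib

/-!
# N07 [B11] (= [15] = [Balaban1985Variational]) Sect. F — MODULES 72 (`…DentPairDataSmall`) AND 72b (`…DentBlockDataSmall` §1) AT PRINT's [II] (2.3) DATUM AND PRINT's (7) DATA: the dent
# letters (two blocks of a dent pair ∕ one dent block) of the chart's top box at a meeting, print-margin-clean datum, from the (2.3) fibre `AgreeOnB (lamBondsSeq s.Ω k) (Ū U) W` and print's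
# top-domain (7) `Sect2.DataSmall7LamTop` — SAME letters `δ_m` (S1c∕C2 of the (E1)∕(iii-b) work plan, director-ym №338∕№339; FLAG №16; LOCATE-HSEAM 5d3298b8d191f169; DOOR-LIST-E1 Tier C2)

Cell `pub-ymgap`, seat `pub-ymgap-dag-n07-e` g34 (FAN-OUT §N07 row s3; LANE OWNER of the K0 road chart side).  `--kind proof --supports stmt-QuantumFields-20541 --as helper` (K0⁷); count-neutral;
def-free; three theorems.  PRINT-DATUM TWINS of `…N07DentPairDataSmall.plaqSmallOn_blowDown_iter_of_below ∕ plaqSmallOn_dentPair_iter_of_data` and `…N07DentBlockDataSmall.plaqSmallOn_dentBlock_iter_of_data`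
(FLAG №16 ∕ LOCATE-HSEAM 5d3298b8d191f169); the (b)-instances stay landed and true on their own text; the datum-free geometry of MODULES 69b ∕ 66 ∕ 57a is cited by name.  No displayed premise is
deleted or weakened except by RE-KEYING to print's objects: `AgreeOn (genSet s.Ω k)` ↦ `AgreeOnB (lamBondsSeq s.Ω k)` ([II] (2.3) «Λ_j = Ω_j^{(j)} ∖ Ω_{j+1}^{(j)} … for the sets of sites and the
sets of bonds», p. 224; ruling (α): the DIFFERENCE of the bond sets — inward connectors belong to no `Λ_j`), `Sect2.DataSmall7PTop` ↦ §7′'s `Sect2.DataSmall7LamTop`, and in the generic lemma the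
«second-kind label» hypothesis carries the conjunct `castSite t ∉ pts (m+1) (Ω (m+1))` (69a₁ᴮ `corner_dichotomyB`).  [15] = [Balaban1985Variational]; [6] = [Balaban1985RegularSpaces];
[II] = [Balaban1984PropagatorsII]; [III] = [Balaban1988Convergent].

WHY ∕ HOW (DOOR-LIST-E1 Tier C2).  A dent block of print's `□′_k^{(k−1)}` is a chart-box label OFF `Γ_{m+1}`; by the dichotomy it is a second-kind vertex (off `Ω_{m+1}^{(m+1)}`, everything below in
`Γ_m`), so every level-`m` plaquette under it has its four corners in `Γ_m` and its four bonds in `Λ_m` (no end-point deep in F0a's block spelling) — a print (7) plaquette of `Sect2.lamPlaqs s.Ω k m`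
on which the fibre reads `M^m U = W_m` — and print's level-`m` clause (for `m = 0` the top-domain clause on `Sect2.lamPlaqsTop`) gives `< δ_m`.  Proofs = the parents' verbatim with `corner_dichotomyB`
and the `Λ`-membership of the four bonds.

WHAT IS PROVED (sorry-free; no definition; axioms standard).  §1 ★★ `plaqSmallOn_blowDown_iter_of_belowB` (generic: a box of second-kind labels).  §2 ★★★ `plaqSmallOn_dentPair_iter_of_dataB`,
★★ `plaqSmallOn_dentBlock_iter_of_dataB` (at the record; binders = parents' with the two re-keyed rows).
HONEST SCOPE.  Count-neutral; elementary fibre bookkeeping; nothing of [15]'s analysis asserted; K0⁷ ∕ K1⁹ NOT closed; N07 NOT discharged; counts unmoved (typed 28∕28 · discharged 8∕28); one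
finite 𝕋⁴ programme at fixed ε — the route closes the conditional finite-𝕋⁴ rung `BalabanLadder.UV` ONLY; the YM mass gap (Clay) is NOT proved by any of this; nothing continuum ∕ ℝ⁴ ∕ OS.
No `sorry`, no `def`, no `instance`, no `notation`.

References: [15] (7) p. 278 L20–33, (144) p. 300, (147) p. 301, (160) p. 303; [6] p. 98; [II] (2.3) p. 224 L10–16; [III] p. 255, (2.2) p. 255, (2.10)–(2.13) pp. 256–257.
-/

set_option autoImplicit false

noncomputable section
open scoped BigOperators Matrix.Norms.L2Operator

namespace Summit.QuantumFields.YangMills.BalabanUVNodes.N07DentDataSmallB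

open Literature.MathematicalPhysics.QuantumFieldTheory.Balaban1983to89
open Literature.MathematicalPhysics.QuantumFieldTheory.Balaban1983to89.Node00
open Literature.MathematicalPhysics.QuantumFieldTheory.Balaban1983to89.B15DeterminingSets
open Literature.MathematicalPhysics.QuantumFieldTheory.Balaban1983to89.B15DeterminingSetsB
open T4Continuum (T4Family)
open T4AxialGaugeSmallField (castSite castSite_apply castSite_add_e boxPlaqs)
open B15Eq112TorusCover (cover)
open B14DomainGeom (Pt Within)
open B7Prop1Explicit (e e_apply)
open B8Eq131Cubes (box bLo bHi sqLo sqHi)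
open B5Eq118OneStroke (iterBlockOf)
open GaugeField (plaqHol)
open B8Eq17ClassAkV1 (plaqsOf mem_plaqsOf)
open Summit.QuantumFields.YangMills.BalabanUVNodes.N07DataDownTheTowerBlowDown (blockOf_mem_box_of_mem_blowDown ediv_mem_Icc_of_mem_blowDown)
open Summit.QuantumFields.YangMills.BalabanUVNodes.N07ChartTopBoxPlaquetteValuesB (corner_dichotomyB)
open Summit.QuantumFields.YangMills.BalabanUVNodes.N07ChartTopBoxDataSmall (unitBox_subset_chartBox exists_mem_box_within_of_mem_chartBox)
open Summit.QuantumFields.YangMills.BalabanUVNodes.N07SplitClauseLevelRaisingMarginWide (chartTopBox_subset_wboxPrint)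
open Summit.QuantumFields.YangMills.BalabanUVNodes.N07RecordDomainsAdm22 (blockSat_seqOfRecord)

/-! ## §1  Generic: a box of second-kind labels, at print's datum -/

section Generic

variable (F : T4Family) (N : ℕ) [NeZero N] (K : ℕ) {m k : ℕ} (Ω : ℕ → Set (Site (F.P K) 0)) (W : MSField (F.P K) (SU N)) (U : GaugeField (F.P K) 0 (SU N))

/-- ★★ **THE PLAQUETTES UNDER A BOX OF SECOND-KIND LABELS ARE PRINT (7) PLAQUETTES, HENCE SMALL** — print-datum twin of `plaqSmallOn_blowDown_iter_of_below` (FLAG №16 ∕ LOCATE-HSEAM 5d3298b8d191f169;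
the (b)-instance stays landed and true on its own text): if every label of `[tlo, thi]` is off `Ω_{m+1}^{(m+1)}` with all level-`m` sites under it in `Γ_m^{(m)}`, then every level-`m` plaquette
based in the blow-down box has its four corners in `Γ_m` and its four bonds in `Λ_m` (fibre: `M^m U = W_m` on them) — a plaquette of `Sect2.lamPlaqs Ω k m` — so print's level-`m` clause (`m ≥ 1`;
for `m = 0` the top-domain clause on `Sect2.lamPlaqsTop Ω Ω₀ k`, the plaquette meeting `Ω₀`) makes it `< a`. [cite: Balaban1985Variational, (7) p.278 L20–33, (160) p.303; Balaban1984PropagatorsII, (2.3) p.224; Balaban1988Convergent, (2.2), (2.10) pp.255–256] -/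
theorem plaqSmallOn_blowDown_iter_of_belowB (hmk : m + 1 ≤ k) (hm : m + 1 ≤ (F.P K).m + (F.P K).K)
    (hfib : AgreeOnB (lamBondsSeq Ω k) (avgFamily (avOfRecord F N K) U) W) {a : ℝ}
    (h7m : 1 ≤ m → ∀ q : Plaq (F.P K) m, q ∈ Sect2.lamPlaqs Ω k m → (∀ c : PBond (F.P K) m,
        (c = ⟨q.src, q.μ⟩ ∨ c = ⟨q.src.shift q.μ, q.ν⟩ ∨ c = ⟨q.src.shift q.ν, q.μ⟩ ∨ c = ⟨q.src, q.ν⟩) → c ∈ lamBondsSeq Ω k m) → dist1 (plaqHol (W m) q) < a)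
    {Ω₀ : Set (Site (F.P K) 0)} (h70 : m = 0 → PlaqSmallOn (Sect2.lamPlaqsTop Ω Ω₀ k) a (W 0))
    {tlo thi : Pt (F.P K).d}
    (hgood2 : ∀ t ∈ Set.Icc tlo thi, (castSite t : Site (F.P K) (m + 1)) ∉ pts (m + 1) (Ω (m + 1)) ∧
      ∀ y' : Site (F.P K) m, blockOf y' = (castSite t : Site (F.P K) (m + 1)) → y' ∈ genSet Ω k m)
    (hsupp : m = 0 → ∀ t ∈ Set.Icc tlo thi, ∀ z ∈ box (F.P K).L t 1 (m + 1), cover (F.P K) z ∈ Ω₀) :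
    PlaqSmallOn (boxPlaqs (fun i => ((F.P K).L : ℤ) * tlo i) (fun i => ((F.P K).L : ℤ) * thi i + (((F.P K).L : ℤ) - 1))) a
      (Averaging.iter (avOfRecord F N K) m U) := by
  intro q hq
  obtain ⟨w, hwlo, hwhi, hwsrc⟩ := hq
  have heμ : ∀ κ i : Fin (F.P K).d, (0 : ℤ) ≤ e κ i ∧ e κ i ≤ 1 := fun κ i => by rw [e_apply]; split_ifs <;> norm_num
  -- the four vertices of `q` as labels in the blow-down box: each lies below a label of `[tlo, thi]`, hence in `Γ_m` with its block off `Ω_{m+1}^{(m+1)}`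
  have hvert : ∀ w' : Pt (F.P K).d, (w' = w ∨ w' = w + e q.μ ∨ w' = w + e q.ν ∨ w' = w + e q.μ + e q.ν) →
      (castSite w' : Site (F.P K) m) ∈ genSet Ω k m ∧ blockOf (castSite w' : Site (F.P K) m) ∉ pts (m + 1) (Ω (m + 1)) := by
    intro w' hw'
    have hw'box : w' ∈ Set.Icc (fun i => ((F.P K).L : ℤ) * tlo i) (fun i => ((F.P K).L : ℤ) * thi i + (((F.P K).L : ℤ) - 1)) := by
      constructor <;> intro i
      · have := hwlo i
        rcases hw' with rfl | rfl | rfl | rfl <;> simp only [Pi.add_apply] <;> linarith [(heμ q.μ i).1, (heμ q.ν i).1]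
      · have := hwhi i
        simp only [Pi.add_apply] at this
        rcases hw' with rfl | rfl | rfl | rfl <;> simp only [Pi.add_apply] <;> linarith [(heμ q.μ i).1, (heμ q.ν i).1]
    obtain ⟨t, htI, htb⟩ := blockOf_mem_box_of_mem_blowDown hm (⟨w', hw'box, rfl⟩ :
      (castSite w' : Site (F.P K) m) ∈ (castSite '' Set.Icc (fun i => ((F.P K).L : ℤ) * tlo i) (fun i => ((F.P K).L : ℤ) * thi i + (((F.P K).L : ℤ) - 1)) : Set (Site (F.P K) m)))
    exact ⟨(hgood2 t htI).2 (castSite w') htb.symm, by rw [← htb]; exact (hgood2 t htI).1⟩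
  have h1 := hvert w (Or.inl rfl)
  have h2 : (castSite w : Site (F.P K) m).shift q.μ ∈ genSet Ω k m ∧ blockOf ((castSite w : Site (F.P K) m).shift q.μ) ∉ pts (m + 1) (Ω (m + 1)) := by
    rw [← castSite_add_e]; exact hvert _ (Or.inr (Or.inl rfl))
  have h3 : (castSite w : Site (F.P K) m).shift q.ν ∈ genSet Ω k m ∧ blockOf ((castSite w : Site (F.P K) m).shift q.ν) ∉ pts (m + 1) (Ω (m + 1)) := by
    rw [← castSite_add_e]; exact hvert _ (Or.inr (Or.inr (Or.inl rfl)))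
  have h4 : ((castSite w : Site (F.P K) m).shift q.μ).shift q.ν ∈ genSet Ω k m ∧ blockOf (((castSite w : Site (F.P K) m).shift q.μ).shift q.ν) ∉ pts (m + 1) (Ω (m + 1)) := by
    rw [← castSite_add_e, ← castSite_add_e]; exact hvert _ (Or.inr (Or.inr (Or.inr rfl)))
  have hcomm : ((castSite w : Site (F.P K) m).shift q.ν).shift q.μ = ((castSite w : Site (F.P K) m).shift q.μ).shift q.ν := by
    have hne : q.μ ≠ q.ν := q.hμν.ne
    simp only [Site.shift, Function.update_of_ne hne, Function.update_of_ne hne.symm]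
    exact (Function.update_comm hne _ _ _).symm
  have h4' : ((castSite w : Site (F.P K) m).shift q.ν).shift q.μ ∈ genSet Ω k m ∧ blockOf (((castSite w : Site (F.P K) m).shift q.ν).shift q.μ) ∉ pts (m + 1) (Ω (m + 1)) := by
    rw [hcomm]; exact h4
  -- all four bonds of `q` are `Λ_m`-bonds: the fibre gives `M^m U = W_m` on them
  have hbonds : ∀ c : PBond (F.P K) m, (c = ⟨q.src, q.μ⟩ ∨ c = ⟨q.src.shift q.μ, q.ν⟩ ∨ c = ⟨q.src.shift q.ν, q.μ⟩ ∨ c = ⟨q.src, q.ν⟩) →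
      c ∈ lamBondsSeq Ω k m := by
    intro c hc
    rw [hwsrc] at hc
    rcases hc with rfl | rfl | rfl | rfl
    · exact ⟨Or.inl h1.1, fun _ => ⟨h1.2, h2.2⟩⟩
    · exact ⟨Or.inl h2.1, fun _ => ⟨h2.2, h4.2⟩⟩
    · exact ⟨Or.inl h3.1, fun _ => ⟨h3.2, h4'.2⟩⟩
    · exact ⟨Or.inl h1.1, fun _ => ⟨h1.2, h3.2⟩⟩
  have hf : ∀ c : PBond (F.P K) m, c ∈ lamBondsSeq Ω k m → Averaging.iter (avOfRecord F N K) m U c = W m c := fun c hc => hfib m c hc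
  have hplaq : plaqHol (Averaging.iter (avOfRecord F N K) m U) q = plaqHol (W m) q := by
    unfold GaugeField.plaqHol
    rw [hf _ (hbonds _ (Or.inl rfl)), hf _ (hbonds _ (Or.inr (Or.inl rfl))), hf _ (hbonds _ (Or.inr (Or.inr (Or.inl rfl)))),
      hf _ (hbonds _ (Or.inr (Or.inr (Or.inr rfl))))]
  rw [hplaq]
  -- `Γ_m` misses `Ω_{m+1}`: the four corners of `q` are off `Ω_{m+1}^{(m)}` — a print (7) plaquette of level `m`
  have hΓ : ∀ y : Site (F.P K) m, y ∈ genSet Ω k m → y ∉ pts m (Ω (m + 1)) := by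
    intro y hy habs
    have hy' : embIter m y ∈ gammaRegion Ω k m := (mem_pts.1 hy)
    rw [mem_pts] at habs
    rcases Nat.eq_zero_or_pos m with h0 | h0
    · subst h0; rw [gammaRegion_zero Ω (by omega)] at hy'; exact hy' habs
    · rw [gammaRegion_mid Ω h0 (by omega)] at hy'; exact hy'.2 habs
  have hlam : q ∈ Sect2.lamPlaqs Ω k m := by
    refine ⟨?_, fun _ => ⟨?_, ?_, ?_, ?_⟩⟩
    · rw [mem_plaqsOf, hwsrc]; exact Or.inl h1.1
    · rw [hwsrc]; exact hΓ _ h1.1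
    · rw [hwsrc]; exact hΓ _ h2.1
    · rw [hwsrc]; exact hΓ _ h3.1
    · rw [hwsrc]; exact hΓ _ h4.1
  rcases Nat.eq_zero_or_pos m with h0 | h0
  · -- level `0`: the top-domain clause; the plaquette meets `Ω₀` at its lower corner
    subst h0
    refine h70 rfl q ⟨hlam, ?_⟩
    rw [mem_plaqsOf, hwsrc]
    left
    have hwbox : w ∈ Set.Icc (fun i => ((F.P K).L : ℤ) * tlo i) (fun i => ((F.P K).L : ℤ) * thi i + (((F.P K).L : ℤ) - 1)) :=
      ⟨hwlo, fun i => by have := hwhi i; simp only [Pi.add_apply] at this ⊢; linarith [(heμ q.μ i).1, (heμ q.ν i).1]⟩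
    have htI := ediv_mem_Icc_of_mem_blowDown (F.P K).L_pos hwbox
    have hunit : w ∈ box (F.P K).L (fun i => w i / ((F.P K).L : ℤ)) 1 (0 + 1) := by
      intro i
      simp only [bLo, bHi, Nat.cast_zero, sub_zero, add_zero, Nat.cast_one, zero_add, pow_one]
      have hL0 : (0 : ℤ) < (F.P K).L := by exact_mod_cast (F.P K).L_pos
      constructor
      · have := Int.ediv_mul_le (w i) hL0.ne'; linarith
      · have := Int.lt_ediv_add_one_mul_self (w i) hL0; linarith
    exact hsupp rfl _ htI w hunit
  · exact h7m h0 q hlam hbonds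

end Generic

/-! ## §2  At the record: the two blocks of a dent pair; one dent block -/

section Record

variable (F : T4Family) (N : ℕ) [NeZero N]

/-- ★★★ **THE TWO-BLOCK LETTER OF A DENT PAIR IS THE (j−1)-DATA's `δ_{j−1}`, AT PRINT's [II] (2.3) DATUM AND PRINT's (7) DATA** — print-datum twin of `plaqSmallOn_dentPair_iter_of_data` (FLAG №16 ∕
LOCATE-HSEAM 5d3298b8d191f169; the (b)-instance stays landed and true on its own text): fibre `AgreeOnB (lamBondsSeq s.Ω k)`, data `Sect2.DataSmall7LamTop`, every other binder identical — (print p. 303 «|V₁(∂p) − 1| < 2L²ε₁ for p ⊂ □̃′^{(k−1)}», at the data itself): at a meeting, print-margin-clean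
datum `(j, idx)`, `j = m + 1`, of a separated run (the binders of MODULE 69b), for two labels `t`, `t + e_μ` of the chart's top box `[sqLo_j − 1, sqHi_j + 1]` that are OFF `Γ_j` (the DENT ∕
collar side: `castSite t, castSite (t + e_μ) ∉ genSet s.Ω k j`), the level-`m` plaquettes of `M^m U` based in the two blocks are `< δ_m` — MODULE 71's `hA` with `a := δ_m`.  Margin ∕ collar
∕ support ∕ saturation discharged as in MODULE 69b; the dichotomy's second branch by MODULE 69a₁ `corner_dichotomy`.
[cite: Balaban1985Variational, (7) p.278, (144) p.300, (160) p.303; Balaban1984PropagatorsII, (2.3) p.224; Balaban1988Convergent, p.255, (2.2), (2.10)–(2.13) pp.255–257; Balaban1985RegularSpaces, p.98] -/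
theorem plaqSmallOn_dentPair_iter_of_dataB {ν : Stage7Numerics} {M : ℕ} {g : ℕ → ℝ} {K k : ℕ} (s : SeqOfRecord F ν M g K k)
    (hsep : Sect2.SeqSeparated ν.M₁ s) (hkK : k ≤ (F.P K).m + (F.P K).K)
    (hgrid : ∀ j : ℕ, 1 ≤ j → j ≤ k → dCubeSide (F.P K).L M (RkOfRecord (F.P K).L ν.r (g j)) j ∣ (F.P K).sitesPerDir 0)
    {Mc ρ : ℕ} (hMc : 1 ≤ Mc) (hρ : 1 ≤ ρ) (hfloor : (11 * (F.P K).d + 4 * ρ + Mc) * (F.P K).L + 3 ≤ ν.M₁)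
    {δ : ℕ → ℝ} (W : MSField (F.P K) (SU N)) (h7 : Sect2.DataSmall7LamTop (avOfRecord F N K) s.Ω (suppDomOfRecord F ν K s.Ω) k δ W)
    (U : GaugeField (F.P K) 0 (SU N)) (hfib : AgreeOnB (lamBondsSeq s.Ω k) (avgFamily (avOfRecord F N K) U) W)
    {m : ℕ} (hjk : m + 1 ≤ k) (hjK : m + 1 ≤ (F.P K).m + (F.P K).K) (idx : Pt (F.P K).d)
    (hmeet : ∃ x ∈ box (F.P K).L (cornerP (F.P K) Mc ρ idx) (sideP (F.P K) Mc ρ) (m + 1), ∃ y : Pt (F.P K).d, cover (F.P K) y ∈ s.Ω (m + 1) ∧ Within ((3 : ℕ) : ℤ) x y)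
    (hclean : m + 1 = k ∨ ∀ z ∈ box (F.P K).L (cornerP (F.P K) Mc ρ idx - ((2 * ρ : ℕ) : Pt (F.P K).d)) (sideP (F.P K) Mc ρ + 2 * (2 * ρ)) (m + 1),
      cover (F.P K) z ∉ s.Ω (m + 1 + 1))
    (t : Pt (F.P K).d) (μ : Fin (F.P K).d)
    (ht : t ∈ Set.Icc (sqLo (F.P K).L (cornerP (F.P K) Mc ρ idx) ρ (m + 1) (m + 1) - 1) (sqHi (F.P K).L (cornerP (F.P K) Mc ρ idx) (sideP (F.P K) Mc ρ) ρ (m + 1) (m + 1) + 1))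
    (htμ : t + e μ ∈ Set.Icc (sqLo (F.P K).L (cornerP (F.P K) Mc ρ idx) ρ (m + 1) (m + 1) - 1) (sqHi (F.P K).L (cornerP (F.P K) Mc ρ idx) (sideP (F.P K) Mc ρ) ρ (m + 1) (m + 1) + 1))
    (hdent : (castSite t : Site (F.P K) (m + 1)) ∉ genSet s.Ω k (m + 1)) (hdentμ : (castSite (t + e μ) : Site (F.P K) (m + 1)) ∉ genSet s.Ω k (m + 1)) :
    PlaqSmallOn (boxPlaqs (fun i => ((F.P K).L : ℤ) * t i) (fun i => ((F.P K).L : ℤ) * (t + e μ) i + (((F.P K).L : ℤ) - 1))) (δ m)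
      (Averaging.iter (avOfRecord F N K) m U) := by
  set c : Pt (F.P K).d := cornerP (F.P K) Mc ρ idx with hc
  set S : ℕ := sideP (F.P K) Mc ρ with hS
  have hν0 : 0 < ν.M₁ := by omega
  have hν1 : 1 ≤ ν.M₁ := hν0
  have hρ0 : 0 < ρ := hρ
  have hS1 : 1 ≤ S := by have := le_sideP (P := F.P K) Mc hρ0; omega
  -- block saturation of `Ω_{m+1}`
  have hsat : ∀ x x' : Site (F.P K) 0, iterBlockOf (m + 1) x = iterBlockOf (m + 1) x' → x ∈ s.Ω (m + 1) → x' ∈ s.Ω (m + 1) :=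
    fun x x' => blockSat_seqOfRecord F ν M g K k hkK s hgrid (m + 1) x x' (by omega) hjk
  -- the data's clauses at level `m`
  have h7m : 1 ≤ m → ∀ q : Plaq (F.P K) m, q ∈ Sect2.lamPlaqs s.Ω k m → (∀ c' : PBond (F.P K) m,
      (c' = ⟨q.src, q.μ⟩ ∨ c' = ⟨q.src.shift q.μ, q.ν⟩ ∨ c' = ⟨q.src.shift q.ν, q.μ⟩ ∨ c' = ⟨q.src, q.ν⟩) → c' ∈ lamBondsSeq s.Ω k m) → dist1 (plaqHol (W m) q) < δ m := by
    intro h1 q hq hb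
    obtain ⟨m', rfl⟩ : ∃ m', m = m' + 1 := ⟨m - 1, by omega⟩
    have h7' := h7.2 m' (by omega) q hq
    have heq : plaqHol (Sect2.mixedFieldB (avOfRecord F N K) (lamBondsSeq s.Ω k (m' + 1)) (W (m' + 1)) (W m')) q = plaqHol (W (m' + 1)) q := by
      unfold GaugeField.plaqHol
      rw [Sect2.mixedFieldB_of_mem _ _ _ (hb _ (Or.inl rfl)), Sect2.mixedFieldB_of_mem _ _ _ (hb _ (Or.inr (Or.inl rfl))),
        Sect2.mixedFieldB_of_mem _ _ _ (hb _ (Or.inr (Or.inr (Or.inl rfl)))), Sect2.mixedFieldB_of_mem _ _ _ (hb _ (Or.inr (Or.inr (Or.inr rfl))))]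
    rwa [heq] at h7'
  have h70 : m = 0 → PlaqSmallOn (Sect2.lamPlaqsTop s.Ω (suppDomOfRecord F ν K s.Ω) k) (δ m) (W 0) := by
    intro h0; subst h0; exact h7.1
  -- (i) margin, (ii) collar, (iii) support — for every label of the chart box (as MODULE 69b)
  have hfar : ∀ t' ∈ Set.Icc (sqLo (F.P K).L c ρ (m + 1) (m + 1) - 1) (sqHi (F.P K).L c S ρ (m + 1) (m + 1) + 1),
      ∀ z ∈ box (F.P K).L t' 1 (m + 1), cover (F.P K) z ∉ s.Ω (m + 2) := by
    intro t' ht' z hz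
    rcases hclean with htop | hcl
    · rw [s.Ω_off (m + 2) (by omega)]; exact Set.notMem_empty _
    · exact hcl z (chartTopBox_subset_wboxPrint (F.P K).L c S (m + 1) hρ (unitBox_subset_chartBox c S ρ (m + 1) ht' hz))
  obtain ⟨x₀, hx₀, y₀, hy₀, hxy₀⟩ := hmeet
  have hcol : 1 ≤ m → ∀ t' ∈ Set.Icc (sqLo (F.P K).L c ρ (m + 1) (m + 1) - 1) (sqHi (F.P K).L c S ρ (m + 1) (m + 1) + 1),
      ∀ z ∈ box (F.P K).L t' 1 (m + 1), cover (F.P K) z ∈ s.Ω m := by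
    intro h1 t' ht' z hz
    obtain ⟨y', hy', hzy'⟩ := exists_mem_box_within_of_mem_chartBox c hS1 hρ (m + 1) ht' hz
    have hfl : 11 * (F.P K).d + 2 * ρ + Mc + 3 + 2 * ρ ≤ ν.M₁ := by
      have hL1 : 1 ≤ (F.P K).L := (F.P K).L_pos
      have : 11 * (F.P K).d + 4 * ρ + Mc ≤ (11 * (F.P K).d + 4 * ρ + Mc) * (F.P K).L := Nat.le_mul_of_pos_right _ hL1
      omega
    have h := Sect2.cover_mem_Ω_pred_of_near_box_propCubeP_box (P := F.P K) hν1 s hsep (Dw := 3) (E := 2 * ρ) hfl (n := m + 1) (by omega) hjk hx₀ hy₀ hxy₀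
      (z := z) (y' := y') hy' (by simpa [mul_comm, mul_assoc] using hzy')
    simpa using h
  have hsupp : m = 0 → ∀ t' ∈ Set.Icc t (t + e μ), ∀ z ∈ box (F.P K).L t' 1 (m + 1), cover (F.P K) z ∈ suppDomOfRecord F ν K s.Ω := by
    intro h0 t' ht' z hz
    subst h0
    -- every label of `[t, t + e_μ]` is a chart-box label
    have ht'box : t' ∈ Set.Icc (sqLo (F.P K).L c ρ (0 + 1) (0 + 1) - 1) (sqHi (F.P K).L c S ρ (0 + 1) (0 + 1) + 1) :=
      ⟨fun i => le_trans (ht.1 i) (ht'.1 i), fun i => le_trans (ht'.2 i) (htμ.2 i)⟩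
    obtain ⟨y', hy', hzy'⟩ := exists_mem_box_within_of_mem_chartBox c hS1 hρ (0 + 1) ht'box hz
    have hbox := within_of_mem_box_of_mem_box (F.P K).L hy' hx₀
    have hw := (hzy'.triangle hbox).triangle hxy₀
    rw [suppDomOfRecord_eq]
    refine cover_mem_hullD_one_of_within hν0 hy₀ (hw.mono ?_)
    have hSle : (S : ℤ) ≤ Mc + 11 * (F.P K).d + 2 * ρ := by exact_mod_cast sideP_le (P := F.P K) Mc ρ
    have hf : (((11 * (F.P K).d + 4 * ρ + Mc) * (F.P K).L + 3 : ℕ) : ℤ) ≤ ν.M₁ := by exact_mod_cast hfloor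
    push_cast at hf ⊢
    have hL0 : (0 : ℤ) ≤ (F.P K).L := by positivity
    nlinarith
  -- the dichotomy's SECOND branch at both labels (they are OFF `Γ_{m+1}`), hence at every label of `[t, t + e_μ]`
  have hlab : ∀ t' ∈ Set.Icc t (t + e μ), t' ∈ Set.Icc (sqLo (F.P K).L c ρ (m + 1) (m + 1) - 1) (sqHi (F.P K).L c S ρ (m + 1) (m + 1) + 1) :=
    fun t' ht' => ⟨fun i => le_trans (ht.1 i) (ht'.1 i), fun i => le_trans (ht'.2 i) (htμ.2 i)⟩
  have heμ : ∀ κ : Fin (F.P K).d, (0 : ℤ) ≤ e μ κ ∧ e μ κ ≤ 1 := fun κ => by rw [e_apply]; split_ifs <;> norm_num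
  have htwo : ∀ t' ∈ Set.Icc t (t + e μ), t' = t ∨ t' = t + e μ := by
    intro t' ht'
    by_cases hμ' : t' μ = t μ
    · left
      funext i
      have a1 : t i ≤ t' i := ht'.1 i
      have a2 : t' i ≤ (t + e μ) i := ht'.2 i
      simp only [Pi.add_apply, e_apply] at a2
      by_cases hi : i = μ
      · subst hi; exact hμ'
      · rw [if_neg hi] at a2; linarith
    · right
      funext i
      have a1 : t i ≤ t' i := ht'.1 i
      have a2 : t' i ≤ (t + e μ) i := ht'.2 i
      simp only [Pi.add_apply, e_apply] at a2 ⊢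
      by_cases hi : i = μ
      · subst hi
        rw [if_pos rfl] at a2 ⊢
        have : t' i ≠ t i := hμ'
        omega
      · rw [if_neg hi] at a2 ⊢; linarith
  have hgood2 : ∀ t' ∈ Set.Icc t (t + e μ), (castSite t' : Site (F.P K) (m + 1)) ∉ pts (m + 1) (s.Ω (m + 1)) ∧
      ∀ y' : Site (F.P K) m, blockOf y' = (castSite t' : Site (F.P K) (m + 1)) → y' ∈ genSet s.Ω k m := by
    intro t' ht'
    have hd := corner_dichotomyB s.Ω hjk hjK hsat (hfar t' (hlab t' ht')) (fun h1 => hcol h1 t' (hlab t' ht'))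
    rcases hd with h | h
    · exfalso
      rcases htwo t' ht' with rfl | rfl
      · exact hdent h
      · exact hdentμ h
    · exact h
  exact plaqSmallOn_blowDown_iter_of_belowB F N K s.Ω W U hjk hjK hfib h7m h70 hgood2 hsupp


/-- ★★ **THE PLAQUETTES OF `M^m U` BASED IN ONE DENT BLOCK ARE `< δ_m`, AT PRINT's [II] (2.3) DATUM AND PRINT's (7) DATA** — print-datum twin of `plaqSmallOn_dentBlock_iter_of_data` (FLAG №16 ∕
LOCATE-HSEAM 5d3298b8d191f169; the (b)-instance stays landed and true on its own text): fibre `AgreeOnB (lamBondsSeq s.Ω k)`, data `Sect2.DataSmall7LamTop`, every other binder identical — — MODULE 72's `plaqSmallOn_dentPair_iter_of_data` for a SINGLE chart-box label `t` off `Γ_{m+1}` (an isolated dent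
block of print's `□′_k^{(k−1)}`): at a meeting, print-margin-clean datum `(m+1, idx)` of a separated run with the grid numerics and the floor `(11d + 4ρ + Mc)·L + 3 ≤ M₁`, every level-`m`
plaquette based in `B(castSite t)` is a printed (7) plaquette of level `m`, hence `< δ_m` by the data (72's record proof on the label interval `[t, t]`).
[cite: Balaban1985Variational, (7) p.278, (147) p.301, (160) p.303; Balaban1984PropagatorsII, (2.3) p.224; Balaban1988Convergent, (2.2), (2.10)–(2.13) pp.255–257; Balaban1985RegularSpaces, p.98] -/
theorem plaqSmallOn_dentBlock_iter_of_dataB {ν : Stage7Numerics} {M : ℕ} {g : ℕ → ℝ} {K k : ℕ} (s : SeqOfRecord F ν M g K k)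
    (hsep : Sect2.SeqSeparated ν.M₁ s) (hkK : k ≤ (F.P K).m + (F.P K).K)
    (hgrid : ∀ j : ℕ, 1 ≤ j → j ≤ k → dCubeSide (F.P K).L M (RkOfRecord (F.P K).L ν.r (g j)) j ∣ (F.P K).sitesPerDir 0)
    {Mc ρ : ℕ} (hMc : 1 ≤ Mc) (hρ : 1 ≤ ρ) (hfloor : (11 * (F.P K).d + 4 * ρ + Mc) * (F.P K).L + 3 ≤ ν.M₁)
    {δ : ℕ → ℝ} (W : MSField (F.P K) (SU N)) (h7 : Sect2.DataSmall7LamTop (avOfRecord F N K) s.Ω (suppDomOfRecord F ν K s.Ω) k δ W)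
    (U : GaugeField (F.P K) 0 (SU N)) (hfib : AgreeOnB (lamBondsSeq s.Ω k) (avgFamily (avOfRecord F N K) U) W)
    {m : ℕ} (hjk : m + 1 ≤ k) (hjK : m + 1 ≤ (F.P K).m + (F.P K).K) (idx : Pt (F.P K).d)
    (hmeet : ∃ x ∈ box (F.P K).L (cornerP (F.P K) Mc ρ idx) (sideP (F.P K) Mc ρ) (m + 1), ∃ y : Pt (F.P K).d, cover (F.P K) y ∈ s.Ω (m + 1) ∧ Within ((3 : ℕ) : ℤ) x y)
    (hclean : m + 1 = k ∨ ∀ z ∈ box (F.P K).L (cornerP (F.P K) Mc ρ idx - ((2 * ρ : ℕ) : Pt (F.P K).d)) (sideP (F.P K) Mc ρ + 2 * (2 * ρ)) (m + 1),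
      cover (F.P K) z ∉ s.Ω (m + 1 + 1))
    (t : Pt (F.P K).d)
    (ht : t ∈ Set.Icc (sqLo (F.P K).L (cornerP (F.P K) Mc ρ idx) ρ (m + 1) (m + 1) - 1) (sqHi (F.P K).L (cornerP (F.P K) Mc ρ idx) (sideP (F.P K) Mc ρ) ρ (m + 1) (m + 1) + 1))
    (hdent : (castSite t : Site (F.P K) (m + 1)) ∉ genSet s.Ω k (m + 1)) :
    PlaqSmallOn (boxPlaqs (fun i => ((F.P K).L : ℤ) * t i) (fun i => ((F.P K).L : ℤ) * t i + (((F.P K).L : ℤ) - 1))) (δ m)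
      (Averaging.iter (avOfRecord F N K) m U) := by
  set c : Pt (F.P K).d := cornerP (F.P K) Mc ρ idx with hc
  set S : ℕ := sideP (F.P K) Mc ρ with hS
  have hν0 : 0 < ν.M₁ := by omega
  have hν1 : 1 ≤ ν.M₁ := hν0
  have hρ0 : 0 < ρ := hρ
  have hS1 : 1 ≤ S := by have := le_sideP (P := F.P K) Mc hρ0; omega
  -- block saturation of `Ω_{m+1}`
  have hsat : ∀ x x' : Site (F.P K) 0, iterBlockOf (m + 1) x = iterBlockOf (m + 1) x' → x ∈ s.Ω (m + 1) → x' ∈ s.Ω (m + 1) :=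
    fun x x' => blockSat_seqOfRecord F ν M g K k hkK s hgrid (m + 1) x x' (by omega) hjk
  -- the data's clauses at level `m`
  have h7m : 1 ≤ m → ∀ q : Plaq (F.P K) m, q ∈ Sect2.lamPlaqs s.Ω k m → (∀ c' : PBond (F.P K) m,
      (c' = ⟨q.src, q.μ⟩ ∨ c' = ⟨q.src.shift q.μ, q.ν⟩ ∨ c' = ⟨q.src.shift q.ν, q.μ⟩ ∨ c' = ⟨q.src, q.ν⟩) → c' ∈ lamBondsSeq s.Ω k m) → dist1 (plaqHol (W m) q) < δ m := by
    intro h1 q hq hb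
    obtain ⟨m', rfl⟩ : ∃ m', m = m' + 1 := ⟨m - 1, by omega⟩
    have h7' := h7.2 m' (by omega) q hq
    have heq : plaqHol (Sect2.mixedFieldB (avOfRecord F N K) (lamBondsSeq s.Ω k (m' + 1)) (W (m' + 1)) (W m')) q = plaqHol (W (m' + 1)) q := by
      unfold GaugeField.plaqHol
      rw [Sect2.mixedFieldB_of_mem _ _ _ (hb _ (Or.inl rfl)), Sect2.mixedFieldB_of_mem _ _ _ (hb _ (Or.inr (Or.inl rfl))),
        Sect2.mixedFieldB_of_mem _ _ _ (hb _ (Or.inr (Or.inr (Or.inl rfl)))), Sect2.mixedFieldB_of_mem _ _ _ (hb _ (Or.inr (Or.inr (Or.inr rfl))))]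
    rwa [heq] at h7'
  have h70 : m = 0 → PlaqSmallOn (Sect2.lamPlaqsTop s.Ω (suppDomOfRecord F ν K s.Ω) k) (δ m) (W 0) := by
    intro h0; subst h0; exact h7.1
  -- (i) margin, (ii) collar — for every label of the chart box (as MODULE 69b ∕ 72)
  have hfar : ∀ t' ∈ Set.Icc (sqLo (F.P K).L c ρ (m + 1) (m + 1) - 1) (sqHi (F.P K).L c S ρ (m + 1) (m + 1) + 1),
      ∀ z ∈ box (F.P K).L t' 1 (m + 1), cover (F.P K) z ∉ s.Ω (m + 2) := by
    intro t' ht' z hz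
    rcases hclean with htop | hcl
    · rw [s.Ω_off (m + 2) (by omega)]; exact Set.notMem_empty _
    · exact hcl z (chartTopBox_subset_wboxPrint (F.P K).L c S (m + 1) hρ (unitBox_subset_chartBox c S ρ (m + 1) ht' hz))
  obtain ⟨x₀, hx₀, y₀, hy₀, hxy₀⟩ := hmeet
  have hcol : 1 ≤ m → ∀ t' ∈ Set.Icc (sqLo (F.P K).L c ρ (m + 1) (m + 1) - 1) (sqHi (F.P K).L c S ρ (m + 1) (m + 1) + 1),
      ∀ z ∈ box (F.P K).L t' 1 (m + 1), cover (F.P K) z ∈ s.Ω m := by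
    intro h1 t' ht' z hz
    obtain ⟨y', hy', hzy'⟩ := exists_mem_box_within_of_mem_chartBox c hS1 hρ (m + 1) ht' hz
    have hfl : 11 * (F.P K).d + 2 * ρ + Mc + 3 + 2 * ρ ≤ ν.M₁ := by
      have hL1 : 1 ≤ (F.P K).L := (F.P K).L_pos
      have : 11 * (F.P K).d + 4 * ρ + Mc ≤ (11 * (F.P K).d + 4 * ρ + Mc) * (F.P K).L := Nat.le_mul_of_pos_right _ hL1
      omega
    have h := Sect2.cover_mem_Ω_pred_of_near_box_propCubeP_box (P := F.P K) hν1 s hsep (Dw := 3) (E := 2 * ρ) hfl (n := m + 1) (by omega) hjk hx₀ hy₀ hxy₀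
      (z := z) (y' := y') hy' (by simpa [mul_comm, mul_assoc] using hzy')
    simpa using h
  -- (iii) support at `m = 0`, for the single label `t`
  have hsupp : m = 0 → ∀ t' ∈ Set.Icc t t, ∀ z ∈ box (F.P K).L t' 1 (m + 1), cover (F.P K) z ∈ suppDomOfRecord F ν K s.Ω := by
    intro h0 t' ht' z hz
    subst h0
    have ht't : t' = t := le_antisymm (fun i => ht'.2 i) (fun i => ht'.1 i)
    subst ht't
    obtain ⟨y', hy', hzy'⟩ := exists_mem_box_within_of_mem_chartBox c hS1 hρ (0 + 1) ht hz
    have hbox := within_of_mem_box_of_mem_box (F.P K).L hy' hx₀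
    have hw := (hzy'.triangle hbox).triangle hxy₀
    rw [suppDomOfRecord_eq]
    refine cover_mem_hullD_one_of_within hν0 hy₀ (hw.mono ?_)
    have hSle : (S : ℤ) ≤ Mc + 11 * (F.P K).d + 2 * ρ := by exact_mod_cast sideP_le (P := F.P K) Mc ρ
    have hf : (((11 * (F.P K).d + 4 * ρ + Mc) * (F.P K).L + 3 : ℕ) : ℤ) ≤ ν.M₁ := by exact_mod_cast hfloor
    push_cast at hf ⊢
    have hL0 : (0 : ℤ) ≤ (F.P K).L := by positivity
    nlinarith
  -- the dichotomy's SECOND branch at `t` (it is OFF `Γ_{m+1}`)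
  have hgood2 : ∀ t' ∈ Set.Icc t t, (castSite t' : Site (F.P K) (m + 1)) ∉ pts (m + 1) (s.Ω (m + 1)) ∧
      ∀ y' : Site (F.P K) m, blockOf y' = (castSite t' : Site (F.P K) (m + 1)) → y' ∈ genSet s.Ω k m := by
    intro t' ht'
    have ht't : t' = t := le_antisymm (fun i => ht'.2 i) (fun i => ht'.1 i)
    subst ht't
    have hd := corner_dichotomyB s.Ω hjk hjK hsat (hfar t' ht) (fun h1 => hcol h1 t' ht)
    rcases hd with h | h
    · exact absurd h hdent
    · exact h
  exact plaqSmallOn_blowDown_iter_of_belowB F N K s.Ω W U hjk hjK hfib h7m h70 hgood2 hsupp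

end Record

end Summit.QuantumFields.YangMills.BalabanUVNodes.N07DentDataSmallB

end
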